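import Summits.PneNP.PneNP.Theorems.ChebyshevTracialDesignPseudoMatchingBaseOneCounts
import Literature.Computability.Complexity.Mod2StoryPseudoexpectation
import Literature.Computability.Complexity.Mod2SymmetricPseudoexpectationInterpolation

/-!
# Cell pnp-psdrank, route `ChebyshevTracialDesign`: TRANSPORT of the pseudo-matching base certificate from the Literature currency
# (`storyMoment` on `K_m = Fin m`) to the tree currency (`ν_W` on a clique `W ⊆ [n]`), and matching-side low-degree pricing for EVERY
# matching-degree `k` modulo the single named fact `Potechin2019_mod2StoryPSD` (crux `TracialDecayExp20`, stmt-PneNP-19878; eng g14, MEMO-14 §3)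

`…PseudoMatchingFormRecursion.form_nonneg_of_base` (p561862) needs, for each `k`, the base certificate «the pseudo-matching form
`δ ↦ Σ_{A,A'} δ_A δ_{A'} ν_W(A ∪ A')` is nonnegative on `{A ⊆ Sym2 (Fin n) : |A| ≤ k}` for every `W ⊆ [n]` with `|W| = m₀`» (`m₀ ≥ 4k+1`), where
`ν_W(G) = [G extends to a perfect matching of K_n, G ⊆ E(W)]·∏_{j<|G|}(|W|−1−2j)⁻¹`. The Literature module `Mod2StoryPseudoexpectation`
(lit g21, p559040) states Potechin's theorem on `K_m = Fin m` with `storyMoment m G = [G a partial matching]·∏_{j<|G|}(m−1−2j)⁻¹`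
[cite: Potechin2019, Example 3.4 and Thm. 1.2 (LIPIcs 124, 61:7, 61:4)]. This file is the relabelling glue between the two:
* §1 the vertex relabelling `φ : Fin |W| ≃ W` (`Finset.equivFin`), the induced INJECTIVE edge map `Sym2.map φ` and edge-set map
  `F ↦ F.image (Sym2.map φ)`; `isPartialMatching_iff_extends` — for `n` even, `F ⊆ E(K_m)` is a partial matching iff its image extends to a
  perfect matching of `K_n` (images lie inside `W` automatically); **`nu_image_eq_storyMoment`**: `ν_W(φ F) = storyMoment |W| F`.
* §2 **`base_form_eq_story_form`** — the tree-currency form at `W` equals the story form at `Fin |W|` on the pulled-back coefficients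
  (indices with an edge leaving `W` or a loop… contribute `0`; the live indices are exactly the images), hence
  **`base_nonneg_of_story_nonneg`**: nonnegativity of the story form on `{F : |F| ≤ k}` at `m` ⇒ the base certificate at every `W` with `|W| = m`.
* §3 **`form_nonneg_of_potechin`** / **`sum_levelWeight_trace_nonpos_of_lowDegreeM_of_potechin`** — with `m = 4k+1` and
  `Potechin2019_mod2StoryPSD.of_card_le`: the base certificate, hence (p561862) matching-side low-degree pricing for EVERY `k`
  (`2k ≤ D`, `4k+1 ≤ t`, `4k+1 ≤ n−t`, cut side ARBITRARY psd), CONDITIONAL on the one named fact `Potechin2019_mod2StoryPSD` BY NAME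
  (printed theorem; printed proof incomplete, repaired on paper in the cell memo LIT-28; `k = 1` is unconditional by `…PseudoMatchingBaseOne`).
  The same glue will turn littype-FN2-1's kernel theorems for the range `6k ≤ m` into an unconditional base at `m₀ = 6k+1`.
* §4 **`sum_levelWeight_trace_nonpos_of_lowDegreeM_of_story`** — the same pricing from a story-form certificate at ANY odd base size `m₀` with
  `4k+1 ≤ m₀ ≤ t`, `m₀ ≤ n − t` (induction `form_nonneg_of_base` from `m₀` + the Kronecker step `…_of_clique_forms`).
* §5 **`sum_levelWeight_trace_nonpos_of_lowDegreeM`** — UNCONDITIONAL pricing for EVERY `k` with `6k+1 ≤ t`, `6k+1 ≤ n − t`: the base at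
  `m₀ = 6k+1` is littype-FN2-1 g8's kernel theorem `PseudoMatching.pseudoMatching_momentForm_nonneg` (p567094, the `n/3` range of Potechin's
  printed argument, 0 named facts), restated as `story_nonneg_of_six_mul_le`.
Stature: support/instrument (relabelling bookkeeping; no definitions; axioms standard; §3 is a `conditional-result` on a Literature fact).
WHAT THIS IS NOT: not a proof of Potechin's theorem, nothing on the dense cell, nothing on psd rank, no P-vs-NP content. Supports stmt-PneNP-19878.
-/

set_option linter.dupNamespace false -- `Summit.PneNP.PneNP.…`: summit = sub-problem (D-0017)

noncomputable section

namespace Summit.PneNP.PneNP.Theorems.ChebyshevTracialDesignPseudoMatchingBaseTransport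

open Finset Matrix Literature.Barriers.PneNP Literature.Combinatorics.Optimization
open Literature.Computability.Complexity.Mod2Story
open Summit.PneNP.PneNP.Theorems.ChebyshevTracialDesignJunta
open Summit.PneNP.PneNP.Theorems.ChebyshevTracialDesignPseudoMatchingFormRecursion
open Summit.PneNP.PneNP.Theorems.ChebyshevTracialDesignPseudoMatchingBaseOne
  (even_of_pmatch extends_of_isPMOn)
open scoped MatrixOrder

variable {n : ℕ}

/-! ### §1 Relabelling a clique `W ⊆ [n]` by `Fin |W|` -/

/-- The relabelling `i ↦ (W.equivFin.symm i : Fin n)` is injective. [folklore] -/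
theorem relabel_injective (W : Finset (Fin n)) :
    Function.Injective (fun i : Fin W.card => ((W.equivFin.symm i : W) : Fin n)) :=
  fun _ _ h => W.equivFin.symm.injective (Subtype.ext h)

/-- The relabelling lands in `W`. [folklore] -/
theorem relabel_mem (W : Finset (Fin n)) (i : Fin W.card) : ((W.equivFin.symm i : W) : Fin n) ∈ W :=
  (W.equivFin.symm i).2

/-- Every vertex of `W` is a relabelled vertex. [folklore] -/
theorem exists_relabel_eq {W : Finset (Fin n)} {a : Fin n} (ha : a ∈ W) :
    ∃ i : Fin W.card, ((W.equivFin.symm i : W) : Fin n) = a :=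
  ⟨W.equivFin ⟨a, ha⟩, by simp⟩

/-- The induced edge map is injective. [folklore] -/
theorem edgeMap_injective (W : Finset (Fin n)) :
    Function.Injective (Sym2.map fun i : Fin W.card => ((W.equivFin.symm i : W) : Fin n)) :=
  Sym2.map.injective (relabel_injective W)

/-- Images of edge sets have the same cardinality. [folklore] -/
theorem card_image_edgeMap (W : Finset (Fin n)) (F : Finset (Sym2 (Fin W.card))) :
    (F.image (Sym2.map fun i : Fin W.card => ((W.equivFin.symm i : W) : Fin n))).card = F.card :=
  card_image_of_injective _ (edgeMap_injective W)

/-- Images of edges lie inside `W`. [folklore] -/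
theorem mem_of_mem_image_edgeMap {W : Finset (Fin n)} {F : Finset (Sym2 (Fin W.card))} {e : Sym2 (Fin n)}
    (he : e ∈ F.image (Sym2.map fun i : Fin W.card => ((W.equivFin.symm i : W) : Fin n))) {x : Fin n} (hx : x ∈ e) :
    x ∈ W := by
  obtain ⟨e', -, rfl⟩ := mem_image.1 he
  obtain ⟨i, -, rfl⟩ := Sym2.mem_map.1 hx
  exact relabel_mem W i

/-- An edge set all of whose edges lie inside `W` is the image of an edge set of `K_{|W|}` (its preimage). [folklore] -/
theorem eq_image_of_inside {W : Finset (Fin n)} {A : Finset (Sym2 (Fin n))} (hA : ∀ e ∈ A, ∀ x ∈ e, x ∈ W) :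
    ∃ F : Finset (Sym2 (Fin W.card)), F.image (Sym2.map fun i : Fin W.card => ((W.equivFin.symm i : W) : Fin n)) = A := by
  classical
  refine ⟨univ.filter fun e' => Sym2.map (fun i : Fin W.card => ((W.equivFin.symm i : W) : Fin n)) e' ∈ A, ?_⟩
  ext e
  simp only [mem_image, mem_filter, mem_univ, true_and]
  constructor
  · rintro ⟨e', he', rfl⟩; exact he'
  · intro he
    induction e using Sym2.ind with
    | h a b =>
      obtain ⟨i, hi⟩ := exists_relabel_eq (hA _ he a (Sym2.mem_mk_left _ _))
      obtain ⟨j, hj⟩ := exists_relabel_eq (hA _ he b (Sym2.mem_mk_right _ _))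
      refine ⟨s(i, j), ?_, ?_⟩
      · rw [Sym2.map_mk, hi, hj]; exact he
      · rw [Sym2.map_mk, hi, hj]

/-- A partial matching of `K_m` is a perfect matching of the vertices it covers. [folklore] -/
theorem isPMOn_verts_of_isPartialMatching {m : ℕ} {F : Finset (Sym2 (Fin m))} (hF : IsPartialMatching F) :
    IsPMOn (verts F) F := by
  classical
  refine ⟨fun e he => ?_, hF.1, fun v hv => ?_⟩
  · rw [mem_sym2_iff]
    intro x hx
    exact mem_verts.2 ⟨e, he, hx⟩
  · obtain ⟨e, he, hve⟩ := mem_verts.1 hv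
    apply le_antisymm (hF.2 v)
    rw [Nat.one_le_iff_ne_zero, ← pos_iff_ne_zero, card_pos]
    exact ⟨e, mem_filter.2 ⟨he, hve⟩⟩

/-- **Partial matchings ↔ extendable images.** For `n` even and `F ⊆ E(K_{|W|})`: `F` is a partial matching iff the relabelled edge set extends
to a perfect matching of `K_n`. [folklore] -/
theorem isPartialMatching_iff_extends (hn : Even n) (W : Finset (Fin n)) (F : Finset (Sym2 (Fin W.card))) :
    IsPartialMatching F ↔ ((univ : Finset (PMatch n)).filter fun M =>
      F.image (Sym2.map fun i : Fin W.card => ((W.equivFin.symm i : W) : Fin n)) ⊆ M.1).Nonempty := by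
  classical
  set φ : Fin W.card → Fin n := fun i => ((W.equivFin.symm i : W) : Fin n) with hφ
  constructor
  · intro hF
    have hP : IsPMOn ((verts F).image φ) (F.image (Sym2.map φ)) :=
      (isPMOn_verts_of_isPartialMatching hF).image φ (relabel_injective W).injOn
    exact extends_of_isPMOn hn hP
  · rintro ⟨M, hM⟩
    have hsub : F.image (Sym2.map φ) ⊆ M.1 := (mem_filter.1 hM).2
    refine ⟨fun e he => ?_, fun v => ?_⟩
    · have hd := M.2.not_isDiag (hsub (mem_image_of_mem _ he))
      rwa [Sym2.isDiag_map (relabel_injective W)] at hd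
    · rw [card_le_one]
      intro e₁ h₁ e₂ h₂
      obtain ⟨he₁, hv₁⟩ := mem_filter.1 h₁
      obtain ⟨he₂, hv₂⟩ := mem_filter.1 h₂
      have := M.2.unique (hsub (mem_image_of_mem _ he₁)) (hsub (mem_image_of_mem _ he₂))
        (Sym2.mem_map.2 ⟨v, hv₁, rfl⟩) (Sym2.mem_map.2 ⟨v, hv₂, rfl⟩)
      exact edgeMap_injective W this

/-- **MOMENT TRANSPORT.** For `n` even: `ν_W(φ F) = storyMoment |W| F` for every edge set `F` of `K_{|W|}` (closed form `hν` of `ν`).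
[cite: Potechin2019, Example 3.4 (LIPIcs 124, 61:7–8)] -/
theorem nu_image_eq_storyMoment (hn : Even n) (ν : Finset (Fin n) → Finset (Sym2 (Fin n)) → ℝ)
    (hν : ∀ W G, ν W G = if ((univ : Finset (PMatch n)).filter fun M => G ⊆ M.1).Nonempty ∧ (∀ e ∈ G, ∀ x ∈ e, x ∈ W) then
      (∏ j ∈ range G.card, ((W.card : ℝ) - 1 - 2 * j))⁻¹ else 0)
    (W : Finset (Fin n)) (F : Finset (Sym2 (Fin W.card))) :
    ν W (F.image (Sym2.map fun i : Fin W.card => ((W.equivFin.symm i : W) : Fin n))) = storyMoment W.card F := by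
  classical
  by_cases hF : IsPartialMatching F
  · rw [storyMoment_of_isPartialMatching hF, hν,
      if_pos ⟨(isPartialMatching_iff_extends hn W F).1 hF, fun e he x hx => mem_of_mem_image_edgeMap he hx⟩,
      card_image_edgeMap]
  · rw [storyMoment_of_not_isPartialMatching hF, hν, if_neg]
    rintro ⟨hext, -⟩
    exact hF ((isPartialMatching_iff_extends hn W F).2 hext)

/-! ### §2 The base form equals the story form on the pulled-back coefficients -/

/-- Reindexing: a sum over `{A ⊆ Sym2 (Fin n) : |A| ≤ k}` of a function vanishing off the edge sets inside `W` is the sum over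
`{F ⊆ Sym2 (Fin |W|) : |F| ≤ k}` of its values on the images. [folklore] -/
theorem sum_eq_sum_image {W : Finset (Fin n)} {k : ℕ} (f : {A : Finset (Sym2 (Fin n)) // A.card ≤ k} → ℝ)
    (hf : ∀ A, (∃ e ∈ A.1, ∃ x ∈ e, x ∉ W) → f A = 0) :
    ∑ A, f A = ∑ F : {F : Finset (Sym2 (Fin W.card)) // F.card ≤ k},
      f ⟨F.1.image (Sym2.map fun i : Fin W.card => ((W.equivFin.symm i : W) : Fin n)),
        (card_image_edgeMap W F.1).le.trans F.2⟩ := by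
  classical
  set ι : {F : Finset (Sym2 (Fin W.card)) // F.card ≤ k} → {A : Finset (Sym2 (Fin n)) // A.card ≤ k} :=
    fun F => ⟨F.1.image (Sym2.map fun i : Fin W.card => ((W.equivFin.symm i : W) : Fin n)),
      (card_image_edgeMap W F.1).le.trans F.2⟩ with hι
  have hinj : Function.Injective ι := by
    intro F F' h
    have h' := congrArg Subtype.val h
    exact Subtype.ext (image_injective (edgeMap_injective W) h')
  -- restrict to the live indices, which are exactly the image of `ι`
  rw [← sum_filter_of_ne (s := univ) (p := fun A : {A : Finset (Sym2 (Fin n)) // A.card ≤ k} => ∀ e ∈ A.1, ∀ x ∈ e, x ∈ W)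
    (fun A _ hA => by by_contra h; push Not at h; exact hA (hf A h))]
  have hset : (univ.filter fun A : {A : Finset (Sym2 (Fin n)) // A.card ≤ k} => ∀ e ∈ A.1, ∀ x ∈ e, x ∈ W) =
      univ.map ⟨ι, hinj⟩ := by
    ext A
    simp only [mem_filter, mem_univ, true_and, mem_map, Function.Embedding.coeFn_mk]
    constructor
    · intro hA
      obtain ⟨F, hF⟩ := eq_image_of_inside hA
      have hFk : F.card ≤ k := by rw [← card_image_edgeMap W F, hF]; exact A.2
      exact ⟨⟨F, hFk⟩, Subtype.ext hF⟩
    · rintro ⟨F, rfl⟩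
      exact fun e he x hx => mem_of_mem_image_edgeMap he hx
  rw [hset, sum_map]
  rfl

/-- **FORM TRANSPORT.** For `n` even, `W ⊆ [n]` and `δ` on `{A : |A| ≤ k}`: the base form `Σ_{A,A'} δ_A δ_{A'} ν_W(A ∪ A')` equals the story form
`Σ_{F,F'} δ'_F δ'_{F'} storyMoment |W| (F ∪ F')` on the pulled-back coefficients `δ'_F = δ_{φ F}`. [cite: Potechin2019, Example 3.4 (LIPIcs 124, 61:7–8)] -/
theorem base_form_eq_story_form (hn : Even n) (ν : Finset (Fin n) → Finset (Sym2 (Fin n)) → ℝ)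
    (hν : ∀ W G, ν W G = if ((univ : Finset (PMatch n)).filter fun M => G ⊆ M.1).Nonempty ∧ (∀ e ∈ G, ∀ x ∈ e, x ∈ W) then
      (∏ j ∈ range G.card, ((W.card : ℝ) - 1 - 2 * j))⁻¹ else 0)
    (W : Finset (Fin n)) {k : ℕ} (δ : {A : Finset (Sym2 (Fin n)) // A.card ≤ k} → ℝ) :
    ∑ A, ∑ A', δ A * δ A' * ν W (A.1 ∪ A'.1) =
      ∑ F : {F : Finset (Sym2 (Fin W.card)) // F.card ≤ k}, ∑ F' : {F : Finset (Sym2 (Fin W.card)) // F.card ≤ k},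
        δ ⟨F.1.image (Sym2.map fun i : Fin W.card => ((W.equivFin.symm i : W) : Fin n)), (card_image_edgeMap W F.1).le.trans F.2⟩ *
        δ ⟨F'.1.image (Sym2.map fun i : Fin W.card => ((W.equivFin.symm i : W) : Fin n)), (card_image_edgeMap W F'.1).le.trans F'.2⟩ *
        storyMoment W.card (F.1 ∪ F'.1) := by
  classical
  -- an edge leaving `W` kills the moment
  have hdead : ∀ G : Finset (Sym2 (Fin n)), (∃ e ∈ G, ∃ x ∈ e, x ∉ W) → ν W G = 0 := by
    rintro G ⟨e, he, x, hx, hxW⟩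
    rw [hν, if_neg]
    rintro ⟨-, hin⟩
    exact hxW (hin e he x hx)
  -- inner sums
  have hinner : ∀ A : {A : Finset (Sym2 (Fin n)) // A.card ≤ k},
      ∑ A', δ A * δ A' * ν W (A.1 ∪ A'.1) = ∑ F' : {F : Finset (Sym2 (Fin W.card)) // F.card ≤ k},
        δ A * δ ⟨F'.1.image (Sym2.map fun i : Fin W.card => ((W.equivFin.symm i : W) : Fin n)),
          (card_image_edgeMap W F'.1).le.trans F'.2⟩ *
        ν W (A.1 ∪ F'.1.image (Sym2.map fun i : Fin W.card => ((W.equivFin.symm i : W) : Fin n))) := by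
    intro A
    rw [sum_eq_sum_image (fun A' => δ A * δ A' * ν W (A.1 ∪ A'.1))]
    rintro A' ⟨e, he, x, hx, hxW⟩
    rw [hdead _ ⟨e, mem_union_right _ he, x, hx, hxW⟩, mul_zero]
  simp_rw [hinner]
  rw [sum_eq_sum_image]
  · refine sum_congr rfl fun F _ => sum_congr rfl fun F' _ => ?_
    rw [← image_union, nu_image_eq_storyMoment hn ν hν]
  · rintro A ⟨e, he, x, hx, hxW⟩
    exact sum_eq_zero fun F' _ => by rw [hdead _ ⟨e, mem_union_left _ he, x, hx, hxW⟩, mul_zero]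

/-- **BASE CERTIFICATE FROM THE STORY FORM.** If for some `m` the story form on `K_m` is nonnegative on `{F : |F| ≤ k}`, then the
pseudo-matching form of EVERY `W ⊆ [n]` with `|W| = m` is nonnegative on `{A : |A| ≤ k}` (any `n`; for odd `n` the form vanishes).
[cite: Potechin2019, Thm. 1.2 (LIPIcs 124, 61:4)] -/
theorem base_nonneg_of_story_nonneg (ν : Finset (Fin n) → Finset (Sym2 (Fin n)) → ℝ)
    (hν : ∀ W G, ν W G = if ((univ : Finset (PMatch n)).filter fun M => G ⊆ M.1).Nonempty ∧ (∀ e ∈ G, ∀ x ∈ e, x ∈ W) then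
      (∏ j ∈ range G.card, ((W.card : ℝ) - 1 - 2 * j))⁻¹ else 0)
    {m k : ℕ} (hstory : ∀ δ' : {F : Finset (Sym2 (Fin m)) // F.card ≤ k} → ℝ,
      0 ≤ ∑ F, ∑ F', δ' F * δ' F' * storyMoment m (F.1 ∪ F'.1))
    (W : Finset (Fin n)) (hW : W.card = m) (δ : {A : Finset (Sym2 (Fin n)) // A.card ≤ k} → ℝ) :
    0 ≤ ∑ A, ∑ A', δ A * δ A' * ν W (A.1 ∪ A'.1) := by
  classical
  by_cases hPM : Nonempty (PMatch n)
  swap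
  · have h0 : ∀ G, ν W G = 0 := fun G => by
      rw [hν, if_neg]
      rintro ⟨⟨M, -⟩, -⟩
      exact hPM ⟨M⟩
    simp [h0]
  obtain ⟨M₀⟩ := hPM
  have hn : Even n := even_of_pmatch M₀
  subst hW
  rw [base_form_eq_story_form hn ν hν W δ]
  exact hstory _

/-! ### §3 Matching-side low-degree pricing for every `k`, modulo `Potechin2019_mod2StoryPSD` -/

/-- **BASE CERTIFICATE AT `|W| = 4k+1` FROM POTECHIN'S THEOREM (named fact).** [cite: Potechin2019, Thm. 1.2 and Cor. 3.10 (LIPIcs 124, 61:4, 61:9)] -/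
theorem form_nonneg_of_potechin (hP : Potechin2019_mod2StoryPSD) (ν : Finset (Fin n) → Finset (Sym2 (Fin n)) → ℝ)
    (hν : ∀ W G, ν W G = if ((univ : Finset (PMatch n)).filter fun M => G ⊆ M.1).Nonempty ∧ (∀ e ∈ G, ∀ x ∈ e, x ∈ W) then
      (∏ j ∈ range G.card, ((W.card : ℝ) - 1 - 2 * j))⁻¹ else 0)
    (k : ℕ) (W : Finset (Fin n)) (hW : W.card = 4 * k + 1) (δ : {A : Finset (Sym2 (Fin n)) // A.card ≤ k} → ℝ) :
    0 ≤ ∑ A, ∑ A', δ A * δ A' * ν W (A.1 ∪ A'.1) :=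
  base_nonneg_of_story_nonneg ν hν (fun δ' => hP.of_card_le (n := 4 * k + 1) ⟨2 * k, by ring⟩ le_rfl δ') W hW δ

/-- **MATCHING-SIDE LOW-DEGREE PRICING FOR EVERY `k`, MODULO POTECHIN'S THEOREM.** Let `n` be even, `(C, w)` an exact design of degree `D` on
the `t`-cuts, `2k ≤ D`, `4k+1 ≤ t`, `4k+1 ≤ n − t`, `X` an ARBITRARY psd cut family and `B` of matching-degree `≤ k` (`IsLowDegreeM n k B`).
If `Potechin2019_mod2StoryPSD` holds then `Σ_U Σ_M levelWeight(U,M)·tr(X_U B_M B_Mᵀ) ≤ 0`. CONDITIONAL on that named fact (printed theorem,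
printed proof incomplete, repaired on paper in LIT-28); `k = 1` is unconditional (`…PseudoMatchingBaseOne`).
[cite: Potechin2019, Thm. 1.2 (LIPIcs 124, 61:4)] [cite: Rothvoss2017, §2 (PDF p. 6)] -/
theorem sum_levelWeight_trace_nonpos_of_lowDegreeM_of_potechin (hP : Potechin2019_mod2StoryPSD) (hn : Even n)
    {t T D : ℕ} {Bv : ℝ} {C : Finset ℕ} {w : ℕ → ℝ} (hdes : IsExactDesign n t T D Bv C w) {r m k : ℕ}
    (h2k : 2 * k ≤ D) (hkt : 4 * k + 1 ≤ t) (hknt : 4 * k + 1 ≤ n - t)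
    (X : OddSet n → Matrix (Fin r) (Fin r) ℝ) (hX : ∀ U, (X U).PosSemidef)
    (B : PMatch n → Matrix (Fin r) (Fin m) ℝ) (hB : IsLowDegreeM n k B) :
    ∑ U, ∑ M, levelWeight n t C w U M * (X U * (B M * (B M)ᵀ)).trace ≤ 0 := by
  set ν : Finset (Fin n) → Finset (Sym2 (Fin n)) → ℝ := fun W G =>
    if ((univ : Finset (PMatch n)).filter fun M => G ⊆ M.1).Nonempty ∧ (∀ e ∈ G, ∀ x ∈ e, x ∈ W) then
      (∏ j ∈ range G.card, ((W.card : ℝ) - 1 - 2 * j))⁻¹ else 0 with hνdef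
  have hν : ∀ W G, ν W G = if ((univ : Finset (PMatch n)).filter fun M => G ⊆ M.1).Nonempty ∧ (∀ e ∈ G, ∀ x ∈ e, x ∈ W) then
      (∏ j ∈ range G.card, ((W.card : ℝ) - 1 - 2 * j))⁻¹ else 0 := fun W G => rfl
  exact sum_levelWeight_trace_nonpos_of_lowDegreeM_of_base hn hdes h2k hkt hknt X hX B hB ν hν
    (fun W hW δ => form_nonneg_of_potechin hP ν hν k W hW δ)

/-! ### §4 Matching-side low-degree pricing from the story form at ANY odd base size `m₀ ≥ 4k+1` -/

/-- **PRICING FROM A STORY-FORM CERTIFICATE AT ANY BASE SIZE.** Let `n` be even, `(C, w)` an exact design of degree `D ≥ 2k` on the `t`-cuts,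
`m₀` odd with `4k+1 ≤ m₀ ≤ t` and `m₀ ≤ n − t`, `X` an ARBITRARY psd cut family and `B` of matching-degree `≤ k`. If the story form of `K_{m₀}` is
nonnegative on `{F : |F| ≤ k}` (e.g. littype-FN2-1's kernel theorems for `6k ≤ m₀`, or `Potechin2019_mod2StoryPSD.of_card_le` at `m₀ = 4k+1`),
then `Σ_U Σ_M levelWeight(U,M)·tr(X_U B_M B_Mᵀ) ≤ 0`. (Base transport §2 + the induction `form_nonneg_of_base` from `m₀` + the Kronecker step
`…_of_clique_forms`.) [cite: Potechin2019, Thm. 1.2 (LIPIcs 124, 61:4)] [cite: Rothvoss2017, §2 (PDF p. 6)] -/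
theorem sum_levelWeight_trace_nonpos_of_lowDegreeM_of_story (hn : Even n) {t T D : ℕ} {Bv : ℝ} {C : Finset ℕ} {w : ℕ → ℝ}
    (hdes : IsExactDesign n t T D Bv C w) {r m k m₀ : ℕ} (h2k : 2 * k ≤ D) (hm₀ : 4 * k + 1 ≤ m₀) (hm₀odd : Odd m₀)
    (hmt : m₀ ≤ t) (hmnt : m₀ ≤ n - t)
    (X : OddSet n → Matrix (Fin r) (Fin r) ℝ) (hX : ∀ U, (X U).PosSemidef)
    (B : PMatch n → Matrix (Fin r) (Fin m) ℝ) (hB : IsLowDegreeM n k B)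
    (hstory : ∀ δ' : {F : Finset (Sym2 (Fin m₀)) // F.card ≤ k} → ℝ, 0 ≤ ∑ F, ∑ F', δ' F * δ' F' * storyMoment m₀ (F.1 ∪ F'.1)) :
    ∑ U, ∑ M, levelWeight n t C w U M * (X U * (B M * (B M)ᵀ)).trace ≤ 0 := by
  classical
  have htodd : Odd t := hdes.1
  set ν : Finset (Fin n) → Finset (Sym2 (Fin n)) → ℝ := fun W G =>
    if ((univ : Finset (PMatch n)).filter fun M => G ⊆ M.1).Nonempty ∧ (∀ e ∈ G, ∀ x ∈ e, x ∈ W) then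
      (∏ j ∈ range G.card, ((W.card : ℝ) - 1 - 2 * j))⁻¹ else 0 with hνdef
  have hν : ∀ W G, ν W G = if ((univ : Finset (PMatch n)).filter fun M => G ⊆ M.1).Nonempty ∧ (∀ e ∈ G, ∀ x ∈ e, x ∈ W) then
      (∏ j ∈ range G.card, ((W.card : ℝ) - 1 - 2 * j))⁻¹ else 0 := fun W G => rfl
  have hall := form_nonneg_of_base ν hν hm₀ (fun W hW δ => base_nonneg_of_story_nonneg ν hν hstory W hW δ)
  refine ChebyshevTracialDesignPseudoMatchingTensor.sum_levelWeight_trace_nonpos_of_lowDegreeM_of_clique_forms hn hdes h2k X hX B hB (fun U hUt δ => ?_) (fun U hUt δ => ?_)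
  · -- the clique `U`: size `t = m₀ + 2i`
    obtain ⟨i, hi⟩ : ∃ i, t = m₀ + 2 * i := by
      obtain ⟨a, ha⟩ := htodd; obtain ⟨b, hb⟩ := hm₀odd; exact ⟨a - b, by omega⟩
    have h := hall i U.1 (by rw [hUt, hi]) δ
    refine le_of_le_of_eq h (sum_congr rfl fun A _ => sum_congr rfl fun A' _ => ?_)
    rw [hν, hUt]
    simp only [cutCount_eq_two_iff]
  · -- the clique `Ū`: size `n − t = m₀ + 2i'`
    obtain ⟨i', hi'⟩ : ∃ i', n - t = m₀ + 2 * i' := by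
      obtain ⟨a, ha⟩ := htodd; obtain ⟨b, hb⟩ := hn; obtain ⟨c, hc⟩ := hm₀odd; exact ⟨b - a - c - 1, by omega⟩
    have hcard : ((univ : Finset (Fin n)) \ U.1).card = n - t := by
      rw [card_sdiff_of_subset (subset_univ _), card_univ, Fintype.card_fin, hUt]
    have h := hall i' ((univ : Finset (Fin n)) \ U.1) (by rw [hcard, hi']) δ
    refine le_of_le_of_eq h (sum_congr rfl fun A _ => sum_congr rfl fun A' _ => ?_)
    rw [hν, hcard]
    simp only [cutCount_eq_zero_iff]

/-! ### §5 UNCONDITIONAL matching-side low-degree pricing for every `k` (base size `6k+1`, from littype-FN2-1's kernel theorems) -/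

/-- The story form of `K_m` is nonnegative on `{F : |F| ≤ k}` whenever `m` is odd and `6k ≤ m` — littype-FN2-1 g8's KERNEL theorem
`PseudoMatching.pseudoMatching_momentForm_nonneg` (Potechin's printed argument, valid in the index-degree `≤ n/3` range), restated in the
`Mod2Story.storyMoment` currency (the two `IsPartialMatching` predicates are definitionally equal). [cite: Potechin2019, Thm. 5.12 and §6 (LIPIcs 124, 61:13–16)] -/
theorem story_nonneg_of_six_mul_le {m k : ℕ} (hm : Odd m) (hk : 6 * k ≤ m)
    (δ' : {F : Finset (Sym2 (Fin m)) // F.card ≤ k} → ℝ) :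
    0 ≤ ∑ F, ∑ F', δ' F * δ' F' * storyMoment m (F.1 ∪ F'.1) := by
  classical
  have h := Literature.Computability.Complexity.PseudoMatching.pseudoMatching_momentForm_nonneg hm hk δ'
  refine le_of_le_of_eq h (sum_congr rfl fun F _ => sum_congr rfl fun F' _ => ?_)
  -- `storyMoment` unfolds to the same `if` (the two `IsPartialMatching` predicates agree definitionally; instances are subsingletons)
  congr 1

/-- **MATCHING-SIDE LOW-DEGREE PRICING FOR EVERY `k`, UNCONDITIONAL.** Let `n` be even, `(C, w)` an exact design of degree `D ≥ 2k` on the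
`t`-cuts with `6k+1 ≤ t` and `6k+1 ≤ n − t`, `X` an ARBITRARY psd cut family and `B` of matching-degree `≤ k` (`IsLowDegreeM n k B`). Then
`Σ_U Σ_M levelWeight(U,M)·tr(X_U B_M B_Mᵀ) ≤ 0`. No named fact: the base certificate at `m₀ = 6k+1` is littype-FN2-1's kernel theorem (§5),
propagated to all clique sizes by `form_nonneg_of_base` and transported by §2. (For `4k+1 ≤ t < 6k+1` use `…_of_potechin`, conditional.)
[cite: Potechin2019, Thm. 1.2 (LIPIcs 124, 61:4)] [cite: Rothvoss2017, §2 (PDF p. 6)] -/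
theorem sum_levelWeight_trace_nonpos_of_lowDegreeM (hn : Even n) {t T D : ℕ} {Bv : ℝ} {C : Finset ℕ} {w : ℕ → ℝ}
    (hdes : IsExactDesign n t T D Bv C w) {r m k : ℕ} (h2k : 2 * k ≤ D) (hkt : 6 * k + 1 ≤ t) (hknt : 6 * k + 1 ≤ n - t)
    (X : OddSet n → Matrix (Fin r) (Fin r) ℝ) (hX : ∀ U, (X U).PosSemidef)
    (B : PMatch n → Matrix (Fin r) (Fin m) ℝ) (hB : IsLowDegreeM n k B) :
    ∑ U, ∑ M, levelWeight n t C w U M * (X U * (B M * (B M)ᵀ)).trace ≤ 0 :=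
  sum_levelWeight_trace_nonpos_of_lowDegreeM_of_story hn hdes (m₀ := 6 * k + 1) h2k (by omega) ⟨3 * k, by ring⟩ hkt hknt X hX B hB
    (story_nonneg_of_six_mul_le ⟨3 * k, by ring⟩ (by omega))

end Summit.PneNP.PneNP.Theorems.ChebyshevTracialDesignPseudoMatchingBaseTransport
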